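import Summits.HodgeConjecture.HodgeConjecture.Theorems.F0P2oK1aWOfLetters                    -- ★ p828026 (B-p18 (g28)): `normOneUnits_le_normOne`, `exists_forall_isThetaCenterChar`
import Summits.HodgeConjecture.HodgeConjecture.Theorems.F0P2oU1DisjointOfTower                -- ★ p828521 (B-p18 (g28)): `continuous_units_of_coe` (and the consumer `u1Disjoint_of_letters`)
import Literature.NumberTheory.Automorphic.Liu2021.Def411WeilCarriersSurvivalNonsplit           -- ★ `compactSpace_localPi_one_of_smul_eq`
import Literature.NumberTheory.Automorphic.UnitaryGroupPlaceInclusion                           -- ★ `inclPlace`, `evalPlace_inclPlace`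
import Literature.NumberTheory.Automorphic.TorusCharacterLocalComponents                         -- ★ `continuous_semilocalComponent`
import HarnessLib

/-!
# Crux `H413`, programme P2 — road (T) «UP THE TOWER», step (1): GLOBALISATION of a character of `E¹_v` to a centre character `χ_f`

Cell hodgecm-mathlib (D-0151), FLOOR 0, crux H413 = stmt-HodgeConjecture-24833; lead B-p18 (g28) (backstop for F0P2-p01 (g7)'s step (1)).  The binder `h1` of the
road-(T) assembly ★ p828521 `F0P2oU1DisjointOfTower.u1Disjoint_of_letters` (text fixed on the P2 bus 16:23:35Z; referee r165 «faithful and provable as typed») asks: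
for a CM field `L`, a conjugate-symplectic `μ`, a NON-SPLIT finite place `v` and a CONTINUOUS character `ψ` of `E¹_v = normOneUnits (c ⊗ 1)`, a continuous unitary
character `χ_f` of `E¹(𝔸_{L⁺,f})` (★ `finAdelicOne`) with ★ `IsThetaCenterChar L μ χf ε v ψ` for EVERY line `ε` — i.e. `χ_{f,v} = (ψ·μ_v) ∘ det` on `U((ε))(L⁺_v)`.
Construction: `χ_f := ((ψ·μ_v|_{E¹_v}) ∘ det ∘ localPiEquiv) ∘ evalPlace_v ∘ (u ↦ u·1₁)` at the line `⟨1⟩` (★ `finAdelicCenter`, ★ `evalPlace`; the two cancellations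
★ `finAdelicCenter_finAdelicCenterInv` and ★ `evalPlace_inclPlace` give the centre-character identity at `⟨1⟩` with no matrix unfolding); unitarity from compactness of
`U(⟨1⟩)(L⁺_v)` at a non-split place (★ `compactSpace_localPi_one_of_smul_eq`; a continuous character of a compact group is unitary, §1); the passage from the line `⟨1⟩` to every
`ε` is ★ p828026 `exists_forall_isThetaCenterChar` + UNIQUENESS of the centre character (§1: `det ∘ θ` is onto `E¹_v`).  THEOREMS ONLY, no named fact, no hypothesis beyond
the binder's own.  HC_CM is proved only modulo the printed citations until rung 0 closes; nothing here proves a letter.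

## References
* [GelbartRogawski1991] Invent. Math. 105: §5.1 (5.1.1) p. 465; proof of Prop. 5.2.1 p. 467 L25–27.  [TateThesis1967] §3.2 Lemma 3.2.1.  [Mok2014] §1 Notation p. 5.
* [PlatonovRapinchuk1994] §5.1, §6.2 (compactness of anisotropic tori).  [Liu2021] App. D §D.1 Step 3.
-/

set_option autoImplicit false
-- the mandated namespace has the single-problem summit's repeated segment (`HodgeConjecture.HodgeConjecture`)
set_option linter.dupNamespace false

noncomputable section

open NumberField IsDedekindDomain MeasureTheory
open scoped Matrix

open Literature.NumberTheory Literature.NumberTheory.Automorphic Literature.NumberTheory.Automorphic.UnitaryGroup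
open Literature.NumberTheory.Automorphic.IdeleClassGroup
open Literature.NumberTheory.Automorphic.Liu2021 Literature.NumberTheory.Automorphic.Liu2021.Def411WeilCarriers
open Literature.NumberTheory.GaloisRepresentations
open Literature.NumberTheory.Rogawski1990
open Literature.NumberTheory.GelbartRogawski1991 Literature.NumberTheory.GelbartRogawski1991.UnitaryDualPair
open Literature.RepresentationTheory.Liu2021

namespace Summit.HodgeConjecture.HodgeConjecture.Cruxes.H413.F0P2oThetaCenterCharGlobalise

variable (L : Type) [Field L] [NumberField L] [IsCMField L]

/-! ## §0 The rank-2 standing data `(2, 1, imagUnit)` at `v` (as in ★ K2 ∕ ★ p828026) -/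

/-- `c (imagUnit L) = −imagUnit L`. [cite: Liu2021, App. D §D.1 Step 1] -/
private theorem hcδ' : IsCMField.complexConj L (imagUnit L) = -imagUnit L := complexConj_imagUnit L

/-- `(1 : M₂(L))` is hermitian. [folklore] -/
private theorem one_map_transpose : ((1 : Matrix (Fin 2) (Fin 2) L).map (IsCMField.complexConj L))ᵀ = 1 := by
  rw [Matrix.map_one (IsCMField.complexConj L) (map_zero _) (map_one _), Matrix.transpose_one]

omit [IsCMField L] in
/-- `det (1 : M₂(L)) ≠ 0`. [folklore] -/
private theorem one_det_ne_zero : (1 : Matrix (Fin 2) (Fin 2) L).det ≠ 0 := by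
  rw [Matrix.det_one]; exact one_ne_zero

omit [IsCMField L] [NumberField L] [Field L] in
/-- The values of a continuous character of a compact group in `ℂˣ` have norm `1` (the image of `‖χ‖` is a bounded subgroup of `ℝ_{>0}`).
(Proof adapted from ★ `Literature.NumberTheory.GaloisRepresentations.norm_apply_eq_one_of_compactSpace_normedField`, restated here to keep the import cone small.) [folklore] -/
theorem norm_apply_eq_one_of_compactSpace {Γ : Type*} [Group Γ] [TopologicalSpace Γ] [CompactSpace Γ] (χ : Γ →* ℂˣ) (hχ : Continuous χ)
    (σ : Γ) : ‖((χ σ : ℂˣ) : ℂ)‖ = 1 := by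
  have hc : Continuous fun τ : Γ => ‖((χ τ : ℂˣ) : ℂ)‖ := continuous_norm.comp (Units.continuous_val.comp hχ)
  obtain ⟨M, hM⟩ := (isCompact_range hc).isBounded.bddAbove
  have hle : ∀ τ : Γ, ‖((χ τ : ℂˣ) : ℂ)‖ ≤ 1 := fun τ => not_lt.mp fun hlt => by
    obtain ⟨m, hm⟩ := pow_unbounded_of_one_lt M hlt
    have hm' : ‖((χ τ : ℂˣ) : ℂ)‖ ^ m ≤ M := by
      have := hM (Set.mem_range_self (τ ^ m))
      simpa only [map_pow, Units.val_pow_eq_pow_val, norm_pow] using this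
    exact absurd hm' (not_le.mpr hm)
  refine le_antisymm (hle σ) ?_
  have h1 := hle σ⁻¹
  rw [map_inv, Units.val_inv_eq_inv_val, norm_inv] at h1
  exact (inv_le_one₀ (norm_pos_iff.mpr (Units.ne_zero _))).mp h1

/-! ## §1 Uniqueness of the centre character -/

set_option synthInstance.maxHeartbeats 400000 in
set_option maxHeartbeats 8000000 in
/-- **The centre character is UNIQUE**: two characters `ψ, ψ'` of `E¹_v` with ★ `IsThetaCenterChar L μ χf ε v ·` at the same line coincide — every
`β ∈ E¹_v` is `det (θ_ε z)` (★ `LemD1OfPlace.theta`, ★ `coe_localDet_localPiEquiv_theta`), where both equal `χ_{f,v}(θ_ε z)·μ_v(β)⁻¹`.  (Any finite `v`.)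
[cite: GelbartRogawski1991, §5.1 (5.1.1) p. 465] [cite: TateThesis1967, §3.2 Lemma 3.2.1] -/
theorem isThetaCenterChar_unique (μ : Literature.NumberTheory.Automorphic.IdeleClassGroup L →ₜ* Circle)
    (χf : UnitaryGroup.finAdelicOne (↥(maximalRealSubfield L)) L (IsCMField.complexConj L) →* ℂˣ) (ε : (↥(maximalRealSubfield L))ˣ)
    (v : HeightOneSpectrum (𝓞 ↥(maximalRealSubfield L))) {ψ ψ' : ↥(normOneUnits (conjLocal L (IsCMField.complexConj L) v)) →* ℂˣ}
    (hψ : IsThetaCenterChar L μ χf ε v ψ) (hψ' : IsThetaCenterChar L μ χf ε v ψ') : ψ = ψ' := by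
  refine MonoidHom.ext fun β => ?_
  -- `β = det (θ_ε z)` with `z = ι β`
  let z : ↥(LemD1OfPlace.standingData L v (IsCMField.complexConj L) 2 (1 : Matrix (Fin 2) (Fin 2) L) (hcδ' L) (imagUnit_ne_zero L)
      le_rfl (one_map_transpose L) (one_det_ne_zero L)).normOne :=
    Subgroup.inclusion (F0P2oK1aWOfLetters.normOneUnits_le_normOne L v) β
  have hd : localDet (IsCMField.complexConj L) v
      (isUnit_iff_ne_zero.mpr (by rw [Matrix.det_fin_one]; exact JW_apply_ne_zero (↥(maximalRealSubfield L)) L ε))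
      (localPiEquiv L (IsCMField.complexConj L) 1 (JW (↥(maximalRealSubfield L)) L ε) v
        (LemD1OfPlace.theta L v (IsCMField.complexConj L) 2 (1 : Matrix (Fin 2) (Fin 2) L) (hcδ' L) (imagUnit_ne_zero L)
          le_rfl (one_map_transpose L) (one_det_ne_zero L) (JW (↥(maximalRealSubfield L)) L ε) z)) = β :=
    Subtype.ext (F0P2oStubDictTorusChar.coe_localDet_localPiEquiv_theta L v _ z)
  have h1 := hψ (LemD1OfPlace.theta L v (IsCMField.complexConj L) 2 (1 : Matrix (Fin 2) (Fin 2) L) (hcδ' L) (imagUnit_ne_zero L)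
    le_rfl (one_map_transpose L) (one_det_ne_zero L) (JW (↥(maximalRealSubfield L)) L ε) z)
  have h2 := hψ' (LemD1OfPlace.theta L v (IsCMField.complexConj L) 2 (1 : Matrix (Fin 2) (Fin 2) L) (hcδ' L) (imagUnit_ne_zero L)
    le_rfl (one_map_transpose L) (one_det_ne_zero L) (JW (↥(maximalRealSubfield L)) L ε) z)
  rw [hd] at h1 h2
  rw [h1, h2]

/-! ## §2 The globalisation -/

set_option synthInstance.maxHeartbeats 400000 in
set_option maxHeartbeats 16000000 in
/-- **(T)(1) GLOBALISATION** (the binder `h1` of ★ `F0P2oU1DisjointOfTower.u1Disjoint_of_letters`, VERBATIM): a continuous character `ψ` of `E¹_v` at a NON-SPLIT `v`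
is the theta centre character of the continuous unitary `χ_f := ((ψ·μ_v) ∘ det ∘ localPiEquiv) ∘ evalPlace_v ∘ (u ↦ u·1₁)` of `E¹(𝔸_{L⁺,f})`, at EVERY line `ε`.
At the line `⟨1⟩`: `χ_{f,v}(u) = χ_f(det (inclPlace_v u)) = (ψ·μ_v)(det u)` by ★ `localCharOfCenter_eq_comp_inclPlace`, ★ `finAdelicCenter_finAdelicCenterInv`, ★ `evalPlace_inclPlace`;
unitarity: `(ψ·μ_v) ∘ det` is a continuous character of the COMPACT `U(⟨1⟩)(L⁺_v)` (★ `compactSpace_localPi_one_of_smul_eq`); every `ε`: ★ `exists_forall_isThetaCenterChar` + §1.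
[cite: GelbartRogawski1991, §5.1 (5.1.1) p. 465; Remark p. 466] [cite: TateThesis1967, §3.2 Lemma 3.2.1] [cite: PlatonovRapinchuk1994, §6.2] -/
theorem exists_chi_isThetaCenterChar :
    ∀ (L : Type) [Field L] [NumberField L] [IsCMField L] (μ : Literature.NumberTheory.Automorphic.IdeleClassGroup L →ₜ* Circle)
      (_hμ : IsConjugateSymplectic L μ) (v : HeightOneSpectrum (𝓞 ↥(maximalRealSubfield L))),
      (∀ w : PlacesOver L v, IsCMField.complexConj L • w.1 = w.1) →
      ∀ (ψ : ↥(normOneUnits (conjLocal L (IsCMField.complexConj L) v)) →* ℂˣ), (Continuous fun β => ((ψ β : ℂˣ) : ℂ)) →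
        ∃ χf : UnitaryGroup.finAdelicOne (↥(maximalRealSubfield L)) L (IsCMField.complexConj L) →* ℂˣ,
          Continuous χf ∧ (∀ z, ‖((χf z : ℂˣ) : ℂ)‖ = 1) ∧ ∀ ε : (↥(maximalRealSubfield L))ˣ, IsThetaCenterChar L μ χf ε v ψ := by
  intro L _ _ _ μ _ v hv ψ hψ
  -- the line `⟨1⟩` and the local character `φ := (ψ·μ_v) ∘ det ∘ localPiEquiv` of `U(⟨1⟩)(L⁺_v)`
  have hJ : IsUnit (JW (↥(maximalRealSubfield L)) L 1).det :=
    isUnit_iff_ne_zero.mpr (by rw [Matrix.det_fin_one]; exact JW_apply_ne_zero (↥(maximalRealSubfield L)) L 1)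
  set φ : ↥(localPi L (IsCMField.complexConj L) 1 (JW (↥(maximalRealSubfield L)) L 1) v) →* ℂˣ :=
    (ψ * ((toHeckeCharacter L μ).semilocalComponent L v).comp (normOneUnits (conjLocal L (IsCMField.complexConj L) v)).subtype).comp
      ((localDet (IsCMField.complexConj L) v hJ).comp (localPiEquiv L (IsCMField.complexConj L) 1 (JW (↥(maximalRealSubfield L)) L 1) v).toMulEquiv.toMonoidHom)
    with hφdef
  have hφc : Continuous φ := by
    have hψu : Continuous (ψ : ↥(normOneUnits (conjLocal L (IsCMField.complexConj L) v)) → ℂˣ) :=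
      F0P2oU1DisjointOfTower.continuous_units_of_coe _ hψ
    have hμc : Continuous (((toHeckeCharacter L μ).semilocalComponent L v).comp
        (normOneUnits (conjLocal L (IsCMField.complexConj L) v)).subtype) :=
      (continuous_semilocalComponent L (toHeckeCharacter L μ)).comp continuous_subtype_val
    have hmul : Continuous (ψ * ((toHeckeCharacter L μ).semilocalComponent L v).comp
        (normOneUnits (conjLocal L (IsCMField.complexConj L) v)).subtype) := by
      exact (hψu.mul hμc).congr fun x => rfl
    exact hmul.comp ((continuous_localDet (IsCMField.complexConj L) v hJ).comp
      (localPiEquiv L (IsCMField.complexConj L) 1 (JW (↥(maximalRealSubfield L)) L 1) v).continuous)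
  -- `χ_f := φ ∘ evalPlace_v ∘ (u ↦ u·1₁)`
  refine ⟨φ.comp ((evalPlace (↥(maximalRealSubfield L)) L (IsCMField.complexConj L) 1 (JW (↥(maximalRealSubfield L)) L 1) v).comp
      (finAdelicCenter (↥(maximalRealSubfield L)) L (IsCMField.complexConj L) 1 (JW (↥(maximalRealSubfield L)) L 1))), ?_, ?_, ?_⟩
  · -- continuity
    exact hφc.comp ((continuous_evalPlace (↥(maximalRealSubfield L)) L (IsCMField.complexConj L) 1 _ v).comp
      (continuous_finAdelicCenter (↥(maximalRealSubfield L)) L (IsCMField.complexConj L) 1 _))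
  · -- unitarity: `φ` is a continuous character of the compact `U(⟨1⟩)(L⁺_v)`
    intro z
    obtain ⟨w⟩ : Nonempty (PlacesOver L v) := inferInstance
    haveI : CompactSpace ↥(localPi L (IsCMField.complexConj L) 1 (JW (↥(maximalRealSubfield L)) L 1) v) :=
      compactSpace_localPi_one_of_smul_eq (IsCMField.complexConj L) (JW (↥(maximalRealSubfield L)) L 1) (IsCMField.complexConj_ne_one L)
        (JW_apply_ne_zero (↥(maximalRealSubfield L)) L 1) w (hv w)
    rw [MonoidHom.comp_apply]
    exact norm_apply_eq_one_of_compactSpace φ hφc _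
  · -- the centre-character identity: at `⟨1⟩` by two cancellations, then every line by uniqueness
    have h1 : IsThetaCenterChar L μ (φ.comp ((evalPlace (↥(maximalRealSubfield L)) L (IsCMField.complexConj L) 1 (JW (↥(maximalRealSubfield L)) L 1) v).comp
        (finAdelicCenter (↥(maximalRealSubfield L)) L (IsCMField.complexConj L) 1 (JW (↥(maximalRealSubfield L)) L 1)))) 1 v ψ := by
      intro u
      rw [localCharOfCenter_eq_comp_inclPlace]
      simp only [MonoidHom.comp_apply, finAdelicCenter_finAdelicCenterInv, evalPlace_inclPlace]
      simp only [hφdef, MonoidHom.comp_apply, MonoidHom.mul_apply, MulEquiv.coe_toMonoidHom, Subgroup.coe_subtype]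
      -- `ψ d = ψ d · μ_v d · (μ_v d)⁻¹` (the two spellings of `d = det u` agree definitionally)
      exact (mul_inv_cancel_right _ _).symm
    intro ε
    obtain ⟨ψθ, hψθ⟩ := F0P2oK1aWOfLetters.exists_forall_isThetaCenterChar L μ
      (φ.comp ((evalPlace (↥(maximalRealSubfield L)) L (IsCMField.complexConj L) 1 (JW (↥(maximalRealSubfield L)) L 1) v).comp
        (finAdelicCenter (↥(maximalRealSubfield L)) L (IsCMField.complexConj L) 1 (JW (↥(maximalRealSubfield L)) L 1)))) v
    rw [isThetaCenterChar_unique L μ _ 1 v h1 (hψθ 1)]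
    exact hψθ ε

end Summit.HodgeConjecture.HodgeConjecture.Cruxes.H413.F0P2oThetaCenterCharGlobalise

end
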